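import Mathlib.NumberTheory.Padics.Complex
import Mathlib.NumberTheory.Padics.ProperSpace
import Mathlib.Analysis.Normed.Field.Krasner
import Mathlib.Analysis.Normed.Field.Approximation
import Mathlib.Analysis.Normed.Module.FiniteDimension
import Mathlib.FieldTheory.IntermediateField.Algebraic
import Mathlib.Topology.Sequences
import HarnessLib

/-!
# A `p`-adic field has only finitely many extensions of bounded degree (inside `Q̄_p`)

We PROVE the classical finiteness theorem (M. Krasner; S. Lang, *Algebraic Number Theory*, II §5
Prop. 14; cited without proof in Bombieri–Gubler, *Heights in Diophantine Geometry*, proof of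
Prop. 4.5.3: "the number of extensions of degree at most `d` is finite"):

* `finite_setOf_intermediateField_finrank_le` — for every prime `p` and every `d`, the set of
  intermediate fields `ℚ_p ⊆ E ⊆ Q̄_p` (`Q̄_p = PadicAlgCl p`, Mathlib's algebraic closure of `ℚ_[p]`
  with its spectral norm) that are finite over `ℚ_p` of degree `≤ d` is FINITE.

This is the named classical input `krasner_finite_subextensions` of the abc-iut campaign-S apex
chain (`[IUTchIV]` Cor. 2.3, "WLOG `K_V` satisfies (∗^{j-inv})"; seat abc-iut-S4's
`GenEllJInvReduction.lean`), proved here from Mathlib alone.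

## The proof (no ramification theory)

The usual proof decomposes an extension into its unramified and totally ramified (Eisenstein)
parts. We avoid that structure theory entirely and use only: Krasner's lemma (Mathlib
`IsKrasner.of_completeSpace`), continuity of roots (Mathlib
`Polynomial.exists_aroots_norm_sub_lt_of_norm_coeff_sub_lt`), local compactness of `ℚ_p`, and an
INDUCTION OVER BASE FIELDS.

* `isCompact_integralRoots` — the set `T_N ⊆ Q̄_p` of roots of monic polynomials of degree `N` over
  `ℚ_p` with coefficients of norm `≤ 1` is COMPACT (sequentially: the coefficient vectors range
  over the compact `ℤ_p^N`; along a convergent subsequence of coefficient vectors the roots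
  accumulate at a root of the limit polynomial, by continuity of roots).
* `finite_setOf_intermediateField_le_finrank_eq` — for every finite subextension `L` and every
  `r`, the set of finite `M ⊇ L` with `[M:ℚ_p] = r·[L:ℚ_p]` is finite, by strong induction on `r`:
  given such `M` with `r ≥ 2`, pick `z₀ ∈ M ∖ L`, subtract a nearest point of `L` (which exists:
  `L` is a finite-dimensional, hence proper, `ℚ_p`-subspace) and rescale by a scalar, obtaining
  `z ∈ M` with `‖z‖ ≤ 1` and `‖z − b‖ ≥ ‖c‖⁻¹` for ALL `b ∈ L` (`c ∈ ℚ_p` any element of norm `> 1`).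
  Such `z` lie in the compact set `T' = T_N ∩ {dist(·, L) ≥ ‖c‖⁻¹}` (`N = [M:ℚ_p]`; the minimal
  polynomial of `z` has integral coefficients since `‖z‖ ≤ 1`, Mathlib `spectralValue_le_one_iff`),
  which is covered by finitely many Krasner balls `B(y_i, ρ_{y_i})`, `y_i ∈ T'`, `ρ_y` = the least
  distance from `y` to another `ℚ_p`-conjugate. Krasner gives `y_i ∈ ℚ_p(z) ⊆ M`, so `M` contains
  `L_i := L ⊔ ℚ_p(y_i)`, a STRICTLY larger base (`y_i ∉ L`), over which `M` has smaller relative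
  degree — and the induction hypothesis at base `L_i` applies.

Everything is stated for `ℚ_[p]` and `PadicAlgCl p` with Mathlib's instances (the statement of the
main theorem is norm-free); the argument works verbatim for any non-archimedean local field of
characteristic `0`.

## References
* S. Lang, *Algebraic Number Theory*, 2nd ed., GTM 110 (1994), Ch. II §5 Prop. 14.
* E. Bombieri, W. Gubler, *Heights in Diophantine Geometry* (2006), proof of Prop. 4.5.3.
  [cite: BombieriGubler2006, Prop 4.5.3]
* J. Neukirch, *Algebraic Number Theory* (1999), Ch. II §6, Exercises 1–2 (continuity of roots,
  Krasner's lemma). [cite: NeukirchANT1999, II §6 Ex. 1-2]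
-/

noncomputable section

open Polynomial IntermediateField Filter Topology Metric

namespace Literature.NumberTheory.LocalFields

variable (p : ℕ) [Fact p.Prime]

/-! ## Integral roots -/

/-- A root in `Q̄_p` of a monic polynomial over `ℚ_p` whose coefficients have norm `≤ 1` has norm
`≤ 1` (ultrametric inequality: `‖y‖^N = ‖Σ_{i<N} c_i y^i‖ ≤ ‖y‖^{N−1}` if `‖y‖ > 1`).
[cite: NeukirchANT1999, II §6 Ex. 1-2] -/
theorem norm_le_one_of_aeval_eq_zero {g : ℚ_[p][X]} (hg : g.Monic) (hc : ∀ i, ‖g.coeff i‖ ≤ 1)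
    {y : PadicAlgCl p} (hy : aeval y g = 0) : ‖y‖ ≤ 1 := by
  by_contra h
  push Not at h
  rcases Nat.eq_zero_or_pos g.natDegree with hN0 | hNpos
  · -- `g = 1`
    have hg1 : g = 1 := (Polynomial.Monic.natDegree_eq_zero hg).mp hN0
    rw [hg1, map_one] at hy
    exact one_ne_zero hy
  obtain ⟨k, hk⟩ : ∃ k, g.natDegree = k + 1 := ⟨g.natDegree - 1, by omega⟩
  -- `y^N = -Σ_{i<N} c_i y^i`
  have hsum : y ^ g.natDegree =
      -∑ i ∈ Finset.range g.natDegree, algebraMap ℚ_[p] (PadicAlgCl p) (g.coeff i) * y ^ i := by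
    have h2 : aeval y g = y ^ g.natDegree + ∑ i ∈ Finset.range g.natDegree,
        algebraMap ℚ_[p] (PadicAlgCl p) (g.coeff i) * y ^ i := by
      conv_lhs => rw [hg.as_sum]
      simp only [map_add, map_pow, aeval_X, map_sum, map_mul, aeval_C]
    rw [hy] at h2
    exact eq_neg_of_add_eq_zero_left h2.symm
  have hbound : ‖y ^ g.natDegree‖ ≤ ‖y‖ ^ k := by
    rw [hsum, norm_neg]
    refine IsUltrametricDist.norm_sum_le_of_forall_le_of_nonneg (by positivity) fun i hi => ?_
    rw [Finset.mem_range] at hi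
    rw [norm_mul, norm_pow, norm_algebraMap']
    calc ‖g.coeff i‖ * ‖y‖ ^ i ≤ 1 * ‖y‖ ^ i :=
          mul_le_mul_of_nonneg_right (hc i) (by positivity)
      _ = ‖y‖ ^ i := one_mul _
      _ ≤ ‖y‖ ^ k := pow_le_pow_right₀ h.le (by omega)
  rw [norm_pow, hk, pow_succ] at hbound
  have hpos : 0 < ‖y‖ ^ k := by positivity
  have h3 : ‖y‖ ^ k * ‖y‖ ≤ ‖y‖ ^ k * 1 := by rw [mul_one]; exact hbound
  have h4 : ‖y‖ ≤ 1 := le_of_mul_le_mul_left h3 hpos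
  linarith

/-- If `z ∈ Q̄_p` has `‖z‖ ≤ 1`, the coefficients of its minimal polynomial over `ℚ_p` have norm
`≤ 1` (the norm of `Q̄_p` IS the spectral norm, `‖z‖ = spectralValue (minpoly z)`, and Mathlib's
`spectralValue_le_one_iff`). [cite: NeukirchANT1999, II §6 Ex. 1-2] -/
theorem norm_coeff_minpoly_le_one {z : PadicAlgCl p} (hz : ‖z‖ ≤ 1) (n : ℕ) :
    ‖(minpoly ℚ_[p] z).coeff n‖ ≤ 1 := by
  have hint : IsIntegral ℚ_[p] z := Algebra.IsIntegral.isIntegral z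
  have h1 : spectralValue (minpoly ℚ_[p] z) ≤ 1 := by
    have h2 : spectralNorm ℚ_[p] (PadicAlgCl p) z = ‖z‖ := PadicAlgCl.spectralNorm_eq p z
    unfold spectralNorm at h2
    rw [h2]; exact hz
  exact (spectralValue_le_one_iff (minpoly.monic hint)).mp h1 n

/-- An element of norm `≤ 1` of a finite subextension `M` of `Q̄_p/ℚ_p` with `[M:ℚ_p] ≤ N` is a root of
a monic polynomial over `ℚ_p` of degree exactly `N` with coefficients of norm `≤ 1` (its minimal
polynomial times a power of `X`). [cite: NeukirchANT1999, II §6 Ex. 1-2] -/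
theorem exists_monic_integral_of_mem {M : IntermediateField ℚ_[p] (PadicAlgCl p)}
    [FiniteDimensional ℚ_[p] M] {z : PadicAlgCl p} (hzM : z ∈ M) (hz : ‖z‖ ≤ 1) {N : ℕ}
    (hN : Module.finrank ℚ_[p] M ≤ N) :
    ∃ g : ℚ_[p][X], g.Monic ∧ g.natDegree = N ∧ (∀ i, ‖g.coeff i‖ ≤ 1) ∧ aeval z g = 0 := by
  have hint : IsIntegral ℚ_[p] z := Algebra.IsIntegral.isIntegral z
  set m := minpoly ℚ_[p] z with hm_def
  have hm : m.Monic := minpoly.monic hint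
  have hdeg : m.natDegree ≤ N := by
    have h1 := minpoly.natDegree_le (A := ℚ_[p]) (⟨z, hzM⟩ : M)
    rw [IntermediateField.minpoly_eq] at h1
    exact h1.trans hN
  refine ⟨m * X ^ (N - m.natDegree), hm.mul (monic_X_pow _), ?_, fun i => ?_, ?_⟩
  · rw [hm.natDegree_mul (monic_X_pow _), natDegree_X_pow]
    omega
  · rw [coeff_mul_X_pow']
    split_ifs
    · exact norm_coeff_minpoly_le_one p hz _
    · simp
  · rw [map_mul, hm_def, minpoly.aeval, zero_mul]

/-! ## The compact set of integral elements of bounded degree -/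

/-- **The roots in `Q̄_p` of the monic polynomials of degree `N` over `ℚ_p` with coefficients of
norm `≤ 1` form a compact set** (continuity of roots + compactness of the coefficient space
`ℤ_p^N`, via sequential compactness). [cite: NeukirchANT1999, II §6 Ex. 1-2] -/
theorem isCompact_integralRoots (N : ℕ) :
    IsCompact {y : PadicAlgCl p | ∃ g : ℚ_[p][X], g.Monic ∧ g.natDegree = N ∧
      (∀ i, ‖g.coeff i‖ ≤ 1) ∧ aeval y g = 0} := by
  classical
  rw [isCompact_iff_isSeqCompact]
  intro u hu
  choose g hgm hgN hgc hgu using hu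
  rcases Nat.eq_zero_or_pos N with hN0 | hNpos
  · exfalso
    have hg1 : g 0 = 1 := (Polynomial.Monic.natDegree_eq_zero (hgm 0)).mp (by rw [hgN 0, hN0])
    have := hgu 0
    rw [hg1, map_one] at this
    exact one_ne_zero this
  -- coefficient vectors in the compact unit ball of `ℚ_p^N`
  set v : ℕ → (Fin N → ℚ_[p]) := fun n i => (g n).coeff i with hv_def
  have hv : ∀ n, v n ∈ closedBall (0 : Fin N → ℚ_[p]) 1 := fun n => by
    rw [mem_closedBall_zero_iff, pi_norm_le_iff_of_nonneg zero_le_one]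
    exact fun i => hgc n i
  obtain ⟨w, hw, φ, hφ, hlim⟩ := (isCompact_closedBall (0 : Fin N → ℚ_[p]) 1).tendsto_subseq hv
  have hw1 : ∀ i, ‖w i‖ ≤ 1 := by
    rw [mem_closedBall_zero_iff, pi_norm_le_iff_of_nonneg zero_le_one] at hw
    exact hw
  -- the limit polynomial
  set q : degreeLT ℚ_[p] N := (degreeLTEquiv ℚ_[p] N).symm w with hq_def
  have hqcoeff : ∀ i : Fin N, (q : ℚ_[p][X]).coeff i = w i := fun i => by
    have h := congrFun (LinearEquiv.apply_symm_apply (degreeLTEquiv ℚ_[p] N) w) i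
    exact h
  have hqdeg : (q : ℚ_[p][X]).degree < N := mem_degreeLT.mp q.2
  set G : ℚ_[p][X] := X ^ N + (q : ℚ_[p][X]) with hG_def
  have hGm : G.Monic := monic_X_pow_add hqdeg
  have hGN : G.natDegree = N := by
    rw [hG_def, natDegree_add_eq_left_of_degree_lt, natDegree_X_pow]
    rw [degree_X_pow]; exact hqdeg
  have hGcoeff_lt : ∀ i : ℕ, ∀ hi : i < N, G.coeff i = w ⟨i, hi⟩ := fun i hi => by
    rw [hG_def, coeff_add, coeff_X_pow, if_neg (by omega), zero_add]
    exact hqcoeff ⟨i, hi⟩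
  have hGcoeff_ge : ∀ i : ℕ, N < i → G.coeff i = 0 := fun i hi =>
    coeff_eq_zero_of_natDegree_lt (by rw [hGN]; exact hi)
  have hGc : ∀ i, ‖G.coeff i‖ ≤ 1 := fun i => by
    rcases lt_trichotomy i N with hi | hi | hi
    · rw [hGcoeff_lt i hi]; exact hw1 _
    · rw [hi, ← hGN, hGm.coeff_natDegree, norm_one]
    · rw [hGcoeff_ge i hi, norm_zero]; exact zero_le_one
  -- coefficientwise distance to `g (φ n)`
  have hdist : ∀ n i, ‖G.coeff i - (g (φ n)).coeff i‖ ≤ ‖w - v (φ n)‖ := fun n i => by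
    rcases lt_trichotomy i N with hi | hi | hi
    · rw [hGcoeff_lt i hi]
      have : (g (φ n)).coeff i = v (φ n) ⟨i, hi⟩ := rfl
      rw [this]
      exact norm_le_pi_norm (w - v (φ n)) ⟨i, hi⟩
    · have hG1 : G.coeff i = 1 := by rw [hi, ← hGN]; exact hGm.coeff_natDegree
      have hg1 : (g (φ n)).coeff i = 1 := by rw [hi, ← hgN (φ n)]; exact (hgm (φ n)).coeff_natDegree
      rw [hG1, hg1, sub_self, norm_zero]; exact norm_nonneg _
    · rw [hGcoeff_ge i hi, coeff_eq_zero_of_natDegree_lt (by rw [hgN]; exact hi), sub_self,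
        norm_zero]
      exact norm_nonneg _
  -- `ε n → 0` strictly dominating the coefficient distance
  set ε : ℕ → ℝ := fun n => ‖w - v (φ n)‖ + 1 / ((n : ℝ) + 1) with hε_def
  have hεpos : ∀ n, 0 < ε n := fun n => by
    have : 0 < 1 / ((n : ℝ) + 1) := by positivity
    have := norm_nonneg (w - v (φ n))
    simp only [hε_def]; linarith
  have hεlim : Tendsto ε atTop (𝓝 0) := by
    have h1 : Tendsto (fun n => ‖w - v (φ n)‖) atTop (𝓝 0) := by
      have h2 : Tendsto (fun n => v (φ n)) atTop (𝓝 w) := hlim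
      rw [tendsto_iff_norm_sub_tendsto_zero] at h2
      simpa [norm_sub_rev] using h2
    have h3 : Tendsto (fun n : ℕ => 1 / ((n : ℝ) + 1)) atTop (𝓝 0) :=
      tendsto_one_div_add_atTop_nhds_zero_nat
    have h4 := h1.add h3
    rw [add_zero] at h4
    exact h4
  -- a root of `G` close to `u (φ n)`
  have hroot : ∀ n, ∃ b ∈ G.aroots (PadicAlgCl p),
      ‖u (φ n) - b‖ < (((N : ℝ) + 1) * ε n) ^ ((N : ℝ)⁻¹) := fun n => by
    obtain ⟨b, hb, hub⟩ := exists_aroots_norm_sub_lt_of_norm_coeff_sub_lt (hεpos n)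
      (hgu (φ n)) (hgm (φ n)) hGm (by rw [hGN, hgN]) (fun i => (hdist n i).trans_lt (by
        simp only [hε_def]; linarith [show (0:ℝ) < 1 / ((n:ℝ) + 1) by positivity]))
      (IsAlgClosed.splits _)
    refine ⟨b, hb, ?_⟩
    have hu1 : max ‖u (φ n)‖ 1 = 1 :=
      max_eq_right (norm_le_one_of_aeval_eq_zero p (hgm (φ n)) (hgc (φ n)) (hgu (φ n)))
    rw [hgN, hu1, mul_one] at hub
    exact hub
  choose b hbG hub using hroot
  set δ : ℕ → ℝ := fun n => (((N : ℝ) + 1) * ε n) ^ ((N : ℝ)⁻¹) with hδ_def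
  have hδlim : Tendsto δ atTop (𝓝 0) := by
    have h1 : Tendsto (fun n => ((N : ℝ) + 1) * ε n) atTop (𝓝 0) := by
      simpa using hεlim.const_mul ((N : ℝ) + 1)
    have h2 := h1.rpow_const (p := (N : ℝ)⁻¹) (Or.inr (by positivity))
    rwa [Real.zero_rpow (inv_ne_zero (Nat.cast_ne_zero.mpr hNpos.ne'))] at h2
  -- pigeonhole on the finite set of roots of `G`
  set R : Finset (PadicAlgCl p) := (G.aroots (PadicAlgCl p)).toFinset with hR_def
  have hbR : ∀ n, b n ∈ R := fun n => Multiset.mem_toFinset.mpr (hbG n)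
  obtain ⟨β, hβR, hfreq⟩ : ∃ β ∈ R, ∃ᶠ n in atTop, b n = β := by
    by_contra hcon
    push Not at hcon
    have hall : ∀ β ∈ R, ∀ᶠ n in atTop, b n ≠ β := fun β hβ => hcon β hβ
    have hev : ∀ᶠ n in atTop, ∀ β ∈ R, b n ≠ β := (Filter.eventually_all_finset R).mpr hall
    obtain ⟨n, hn⟩ := hev.exists
    exact hn (b n) (hbR n) rfl
  obtain ⟨ψ, hψ, hbψ⟩ := extraction_of_frequently_atTop hfreq
  have hβroot : aeval β G = 0 := (mem_aroots.mp (Multiset.mem_toFinset.mp hβR)).2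
  refine ⟨β, ⟨G, hGm, hGN, hGc, hβroot⟩, φ ∘ ψ, hφ.comp hψ, ?_⟩
  rw [tendsto_iff_norm_sub_tendsto_zero]
  refine squeeze_zero (fun n => norm_nonneg _) (fun n => ?_) (hδlim.comp hψ.tendsto_atTop)
  have := hub (ψ n)
  rw [hbψ n] at this
  exact this.le

/-! ## Krasner radii -/

/-- Every `y ∈ Q̄_p` has a **Krasner radius**: a `ρ > 0` not exceeding the distance from `y` to any
OTHER `ℚ_p`-conjugate of `y`. [cite: NeukirchANT1999, II §6 Ex. 1-2] -/
theorem exists_krasner_radius (y : PadicAlgCl p) :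
    ∃ ρ : ℝ, 0 < ρ ∧ ∀ x' : PadicAlgCl p, IsConjRoot ℚ_[p] y x' → y ≠ x' → ρ ≤ ‖y - x'‖ := by
  classical
  have hint : IsIntegral ℚ_[p] y := Algebra.IsIntegral.isIntegral y
  set R : Finset (PadicAlgCl p) := ((minpoly ℚ_[p] y).aroots (PadicAlgCl p)).toFinset.erase y
    with hR_def
  have hmemR : ∀ x', IsConjRoot ℚ_[p] y x' → y ≠ x' → x' ∈ R := fun x' hc hne => by
    rw [hR_def, Finset.mem_erase, Multiset.mem_toFinset, mem_aroots]
    exact ⟨Ne.symm hne, minpoly.ne_zero hint, (isConjRoot_iff_aeval_eq_zero hint).mp hc⟩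
  by_cases hR : R.Nonempty
  · refine ⟨R.inf' hR fun x => ‖y - x‖, ?_, fun x' hc hne => Finset.inf'_le _ (hmemR x' hc hne)⟩
    rw [Finset.lt_inf'_iff]
    intro x hx
    rw [hR_def, Finset.mem_erase] at hx
    exact norm_pos_iff.mpr (sub_ne_zero.mpr (Ne.symm hx.1))
  · exact ⟨1, one_pos, fun x' hc hne => absurd ⟨x', hmemR x' hc hne⟩ hR⟩

/-- **Krasner's lemma, ball form**: if `‖y − z‖ < ρ_y` for a Krasner radius `ρ_y` of `y`, then
`y ∈ ℚ_p(z)` (Mathlib `IsKrasner.of_completeSpace` for `Q̄_p/ℚ_p`).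
[cite: NeukirchANT1999, II §6 Ex. 1-2] -/
theorem mem_adjoin_of_norm_sub_lt {y z : PadicAlgCl p} {ρ : ℝ}
    (hρ : ∀ x' : PadicAlgCl p, IsConjRoot ℚ_[p] y x' → y ≠ x' → ρ ≤ ‖y - x'‖)
    (h : ‖y - z‖ < ρ) : y ∈ ℚ_[p]⟮z⟯ :=
  IsKrasner.krasner (K := ℚ_[p]) (Algebra.IsSeparable.isSeparable ℚ_[p] y) (IsAlgClosed.splits _)
    (Algebra.IsIntegral.isIntegral z) fun x' hc hne => h.trans_le (hρ x' hc hne)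

/-! ## Normalised witnesses -/

/-- **Normalisation.** If `L < M` are subextensions of `Q̄_p/ℚ_p` with `L` finite over `ℚ_p`, and
`c ∈ ℚ_p` has `‖c‖ > 1`, then `M` contains an element `z` with `‖z‖ ≤ 1` whose distance to EVERY
element of `L` is `≥ ‖c‖⁻¹` (subtract from any `z₀ ∈ M ∖ L` a nearest point of the finite-dimensional,
hence proper, `ℚ_p`-subspace `L`, and rescale). [cite: NeukirchANT1999, II §6 Ex. 1-2] -/
theorem exists_mem_norm_le_one_forall_le_norm_sub {L M : IntermediateField ℚ_[p] (PadicAlgCl p)}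
    [FiniteDimensional ℚ_[p] L] (hLM : L ≤ M) (hne : L ≠ M) {c : ℚ_[p]} (hc : 1 < ‖c‖) :
    ∃ z : PadicAlgCl p, z ∈ M ∧ ‖z‖ ≤ 1 ∧ ∀ b ∈ L, ‖c‖⁻¹ ≤ ‖z - b‖ := by
  obtain ⟨z₀, hz₀M, hz₀L⟩ := SetLike.exists_of_lt (lt_of_le_of_ne hLM hne)
  haveI : ProperSpace L := FiniteDimensional.proper ℚ_[p] L
  -- a nearest point `a ∈ L` to `z₀`
  have hK : IsCompact (closedBall (0 : L) ‖z₀‖) := isCompact_closedBall _ _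
  have hcont : ContinuousOn (fun b : L => ‖z₀ - (b : PadicAlgCl p)‖) (closedBall (0 : L) ‖z₀‖) :=
    (continuous_const.sub continuous_subtype_val).norm.continuousOn
  obtain ⟨a, haK, hamin⟩ := hK.exists_isMinOn ⟨0, mem_closedBall_self (norm_nonneg _)⟩ hcont
  rw [isMinOn_iff] at hamin
  have ha0 : ‖z₀ - (a : PadicAlgCl p)‖ ≤ ‖z₀‖ := by
    have h := hamin 0 (mem_closedBall_self (norm_nonneg z₀))
    simp only [ZeroMemClass.coe_zero, sub_zero] at h
    exact h
  have hmin : ∀ b ∈ L, ‖z₀ - (a : PadicAlgCl p)‖ ≤ ‖z₀ - b‖ := by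
    intro b hb
    by_cases hbn : ‖b‖ ≤ ‖z₀‖
    · have hbK : (⟨b, hb⟩ : L) ∈ closedBall (0 : L) ‖z₀‖ := by
        rw [mem_closedBall_zero_iff]
        exact hbn
      exact hamin ⟨b, hb⟩ hbK
    · push Not at hbn
      have h1 : ‖b‖ ≤ max ‖b - z₀‖ ‖z₀‖ := by
        have := IsUltrametricDist.norm_add_le_max (b - z₀) z₀
        rwa [sub_add_cancel] at this
      have h2 : ‖z₀‖ < ‖b - z₀‖ := by
        rcases le_max_iff.mp h1 with h | h
        · exact hbn.trans_le h
        · exact absurd h (not_le.mpr hbn)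
      rw [norm_sub_rev] at h2
      linarith
  obtain ⟨w, hw_def⟩ : ∃ w : PadicAlgCl p, w = z₀ - (a : PadicAlgCl p) := ⟨_, rfl⟩
  have haL : (a : PadicAlgCl p) ∈ L := a.2
  have hw0 : w ≠ 0 := by
    intro h
    rw [hw_def, sub_eq_zero] at h
    exact hz₀L (h ▸ haL)
  have hwL : ∀ b ∈ L, ‖w‖ ≤ ‖w - b‖ := fun b hb => by
    have : w - b = z₀ - ((a : PadicAlgCl p) + b) := by rw [hw_def]; ring
    rw [this, hw_def]
    exact hmin _ (L.add_mem haL hb)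
  obtain ⟨d, hd0, hd1, hd2, -⟩ := rescale_to_shell hc one_pos hw0
  refine ⟨d • w, ?_, hd1.le, fun b hb => ?_⟩
  · rw [hw_def, smul_sub]
    exact M.sub_mem (M.smul_mem hz₀M) (M.smul_mem (hLM haL))
  · have hdb : d⁻¹ • b ∈ L := L.smul_mem hb
    have h1 : d • w - b = d • (w - d⁻¹ • b) := by
      rw [smul_sub, smul_inv_smul₀ hd0]
    rw [h1, norm_smul]
    calc ‖c‖⁻¹ = 1 / ‖c‖ := (one_div _).symm
      _ ≤ ‖d • w‖ := hd2
      _ = ‖d‖ * ‖w‖ := norm_smul _ _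
      _ ≤ ‖d‖ * ‖w - d⁻¹ • b‖ := mul_le_mul_of_nonneg_left (hwL _ hdb) (norm_nonneg _)

/-! ## Finiteness, by induction over base fields -/

/-- **Finitely many extensions of given relative degree over every finite base** (the induction):
for every finite subextension `L` of `Q̄_p/ℚ_p` and every `r`, the set of finite subextensions
`M ⊇ L` with `[M:ℚ_p] = r·[L:ℚ_p]` is finite. Strong induction on `r` (see the module docstring):
a normalised witness `z ∈ M` lies in one of finitely many Krasner balls covering a compact set of
integral elements avoiding `L`; the centre `y_i` of that ball lies in `M` by Krasner's lemma, and
`M` has smaller relative degree over the strictly larger base `L ⊔ ℚ_p(y_i)`.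
[cite: BombieriGubler2006, Prop 4.5.3] -/
theorem finite_setOf_intermediateField_le_finrank_eq (r : ℕ) :
    ∀ (L : IntermediateField ℚ_[p] (PadicAlgCl p)), FiniteDimensional ℚ_[p] L →
      {M : IntermediateField ℚ_[p] (PadicAlgCl p) | FiniteDimensional ℚ_[p] M ∧ L ≤ M ∧
        Module.finrank ℚ_[p] M = r * Module.finrank ℚ_[p] L}.Finite := by
  classical
  induction r using Nat.strong_induction_on with
  | _ r IH =>
  intro L hL
  rcases Nat.lt_or_ge r 2 with hr | hr
  · -- `r = 0`: empty; `r = 1`: only `M = L`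
    refine (Set.finite_singleton L).subset ?_
    rintro M ⟨hM, hLM, hfin⟩
    haveI := hM
    interval_cases r
    · exfalso
      rw [zero_mul] at hfin
      exact Module.finrank_pos.ne' hfin
    · rw [one_mul] at hfin
      exact (IntermediateField.eq_of_le_of_finrank_eq hLM hfin.symm).symm
  -- `r ≥ 2`
  obtain ⟨c, hc⟩ : ∃ c : ℚ_[p], 1 < ‖c‖ := NormedField.exists_one_lt_norm ℚ_[p]
  have hc0 : 0 < ‖c‖ := zero_lt_one.trans hc
  set m : ℕ := Module.finrank ℚ_[p] L with hm_def
  have hmpos : 0 < m := Module.finrank_pos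
  set N : ℕ := r * m with hN_def
  -- the compact set of normalised witnesses
  set T : Set (PadicAlgCl p) := {y | ∃ g : ℚ_[p][X], g.Monic ∧ g.natDegree = N ∧
      (∀ i, ‖g.coeff i‖ ≤ 1) ∧ aeval y g = 0} with hT_def
  set T' : Set (PadicAlgCl p) := T ∩ {y | ∀ b ∈ L, ‖c‖⁻¹ ≤ ‖y - b‖} with hT'_def
  have hT'c : IsCompact T' := by
    refine (isCompact_integralRoots p N).inter_right ?_
    have : {y : PadicAlgCl p | ∀ b ∈ L, ‖c‖⁻¹ ≤ ‖y - b‖} =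
        ⋂ b ∈ (L : Set (PadicAlgCl p)), {y | ‖c‖⁻¹ ≤ ‖y - b‖} := by
      ext y; simp
    rw [this]
    exact isClosed_biInter fun b _ =>
      isClosed_le continuous_const (continuous_id.sub continuous_const).norm
  have hT'L : ∀ y ∈ T', y ∉ L := fun y hy hyL => by
    have := hy.2 y hyL
    rw [sub_self, norm_zero] at this
    exact absurd this (not_le.mpr (inv_pos.mpr hc0))
  -- Krasner radii and a finite subcover of `T'`
  choose ρ hρ0 hρ using exists_krasner_radius p
  obtain ⟨t, ht⟩ := hT'c.elim_finite_subcover (fun y : T' => ball (y : PadicAlgCl p) (ρ y))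
    (fun _ => isOpen_ball) fun y hy => Set.mem_iUnion.mpr ⟨⟨y, hy⟩, mem_ball_self (hρ0 y)⟩
  -- the strictly larger bases `L_i = L ⊔ ℚ_p(y_i)`
  let Lsup : T' → IntermediateField ℚ_[p] (PadicAlgCl p) := fun y => L ⊔ ℚ_[p]⟮(y : PadicAlgCl p)⟯
  have hLsup_fd : ∀ y : T', FiniteDimensional ℚ_[p] (Lsup y) := fun y => by
    haveI := hL
    haveI : FiniteDimensional ℚ_[p] ℚ_[p]⟮(y : PadicAlgCl p)⟯ :=
      adjoin.finiteDimensional (Algebra.IsIntegral.isIntegral _)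
    exact IntermediateField.finiteDimensional_sup L _
  have hLsup_lt : ∀ y : T', m < Module.finrank ℚ_[p] (Lsup y) := fun y => by
    haveI := hLsup_fd y
    have hle : L ≤ Lsup y := le_sup_left
    have hdvd := IntermediateField.finrank_dvd_of_le_right hle
    have hne : Module.finrank ℚ_[p] L ≠ Module.finrank ℚ_[p] (Lsup y) := by
      intro h
      have heq := IntermediateField.eq_of_le_of_finrank_eq hle h
      have hyL : (y : PadicAlgCl p) ∈ Lsup y :=
        (le_sup_right : ℚ_[p]⟮(y : PadicAlgCl p)⟯ ≤ Lsup y) (mem_adjoin_simple_self ℚ_[p] _)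
      rw [← heq] at hyL
      exact hT'L y y.2 hyL
    have hpos : 0 < Module.finrank ℚ_[p] (Lsup y) := Module.finrank_pos
    exact Nat.lt_of_le_of_ne (Nat.le_of_dvd hpos hdvd) hne
  -- the candidate families given by the induction hypothesis at the bases `L_i`
  refine (Set.Finite.biUnion (Finset.finite_toSet t) (fun y _ =>
    IH (N / Module.finrank ℚ_[p] (Lsup y)) ?_ (Lsup y) (hLsup_fd y))).subset ?_
  · -- the relative degree drops: `N / [L_i:ℚ_p] < r`
    have h1 := hLsup_lt y
    have hmi : 0 < Module.finrank ℚ_[p] (Lsup y) := hmpos.trans h1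
    rw [Nat.div_lt_iff_lt_mul hmi, hN_def]
    exact Nat.mul_lt_mul_of_pos_left h1 (by omega)
  · -- every `M` of the family lies in one of them
    rintro M ⟨hM, hLM, hfin⟩
    haveI := hM
    have hne : L ≠ M := by
      intro h
      rw [← h, ← hm_def] at hfin
      nlinarith
    obtain ⟨z, hzM, hz1, hzL⟩ := exists_mem_norm_le_one_forall_le_norm_sub p hLM hne hc
    have hzT : z ∈ T := by
      obtain ⟨g, hg⟩ := exists_monic_integral_of_mem p hzM hz1 (N := N) hfin.le
      exact ⟨g, hg⟩
    have hzT' : z ∈ T' := ⟨hzT, hzL⟩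
    obtain ⟨y, hyt, hzy⟩ : ∃ y ∈ t, z ∈ ball (y : PadicAlgCl p) (ρ y) := by
      have := ht hzT'
      simp only [Set.mem_iUnion] at this
      obtain ⟨y, hyt, hzy⟩ := this
      exact ⟨y, hyt, hzy⟩
    -- Krasner: `y ∈ ℚ_p(z) ⊆ M`
    have hyz : ‖(y : PadicAlgCl p) - z‖ < ρ y := by rw [norm_sub_rev]; exact mem_ball_iff_norm.mp hzy
    have hyM : (y : PadicAlgCl p) ∈ M :=
      adjoin_simple_le_iff.mpr hzM (mem_adjoin_of_norm_sub_lt p (hρ y) hyz)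
    have hLiM : Lsup y ≤ M := sup_le hLM (adjoin_simple_le_iff.mpr hyM)
    haveI := hLsup_fd y
    refine Set.mem_biUnion (Finset.mem_coe.mpr hyt) ⟨hM, hLiM, ?_⟩
    -- `[M:ℚ_p] = (N / [L_i:ℚ_p]) · [L_i:ℚ_p]`
    obtain ⟨k, hk⟩ := IntermediateField.finrank_dvd_of_le_right hLiM
    have hmi : 0 < Module.finrank ℚ_[p] (Lsup y) := Module.finrank_pos
    rw [hfin] at hk
    rw [hfin, hk, Nat.mul_div_cancel_left _ hmi, mul_comm]

/-- **A `p`-adic field has only finitely many extensions of bounded degree inside `Q̄_p`**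
(M. Krasner; Lang, *Algebraic Number Theory* II §5 Prop. 14; Bombieri–Gubler, proof of Prop. 4.5.3):
for every `d`, the intermediate fields `ℚ_p ⊆ E ⊆ Q̄_p` that are finite over `ℚ_p` with
`[E:ℚ_p] ≤ d` form a finite set. PROVED (from `finite_setOf_intermediateField_le_finrank_eq` at
the base `⊥ = ℚ_p`). [cite: BombieriGubler2006, Prop 4.5.3] -/
theorem finite_setOf_intermediateField_finrank_le (d : ℕ) :
    {E : IntermediateField ℚ_[p] (PadicAlgCl p) | FiniteDimensional ℚ_[p] E ∧
      Module.finrank ℚ_[p] E ≤ d}.Finite := by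
  haveI : FiniteDimensional ℚ_[p] (⊥ : IntermediateField ℚ_[p] (PadicAlgCl p)) := inferInstance
  refine (Set.Finite.biUnion (Set.finite_Iic d) fun N _ =>
    finite_setOf_intermediateField_le_finrank_eq p N ⊥ inferInstance).subset ?_
  rintro E ⟨hE, hd⟩
  refine Set.mem_biUnion (Set.mem_Iic.mpr hd) ⟨hE, bot_le, ?_⟩
  rw [IntermediateField.finrank_bot, mul_one]

/-- Variant with `0 < [E:ℚ_p]` in place of the finite-dimensionality hypothesis (`Module.finrank` is
`0` for infinite-dimensional `E`, and positive rank forces finite dimension).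
[cite: BombieriGubler2006, Prop 4.5.3] -/
theorem finite_setOf_intermediateField_finrank_pos_le (d : ℕ) :
    {E : IntermediateField ℚ_[p] (PadicAlgCl p) | 0 < Module.finrank ℚ_[p] E ∧
      Module.finrank ℚ_[p] E ≤ d}.Finite := by
  refine (finite_setOf_intermediateField_finrank_le p d).subset ?_
  rintro E ⟨hpos, hd⟩
  exact ⟨Module.finite_of_finrank_pos hpos, hd⟩

end Literature.NumberTheory.LocalFields

end
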